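import Summits.CriticalPhenomena.SAWScalingLimit.Theorems.AnnularMassDecay.Negative.LoadBearing

/-!
# A re-entrant skipping member (line `radial-renewal-kesten-inequality`, stub S3)

Line `radial-renewal-kesten-inequality` of the crux `AnnularMassDecay` (stmt-CriticalPhenomena-4729),
support for the OPEN stub S3 `stub_skipTail`.  The skip family of S3 (level-`ρ_u/A` chain-stopped
members from `u` with end radius `≤ ρ_u/(AB)`) is NOT contained in any of the crux's first-entry
annular families `annMass z s' R u N` with inner radius `s' ≥ 1` (the only ones the crux controls):
`rr_st_reentrant_example` exhibits, for `z = 0`, `u = (4,0)`, `A = B = 2` (so `ρ_u = 4`, renewal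
level `2`, end level `1`), the 8-step walk
`(4,0) → (3,0) → (2,0) → (1,0) → (1,1) → (1,2) → (0,2) → (0,1) → (0,0)`,
which satisfies the skip clauses verbatim (it is confined to the open disc of radius `4`; its end
`(0,0)` is the strict radial minimum, of radius `0 ≤ 1`; its strict records of radius `≤ 2` before the
end, `(2,0)` and `(1,0)`, are undone by the later visit to `(1,2)` at radius `√5`, so neither is a
renewal) but visits radius `1` at the interior time `3`: it enters the closed unit disc, leaves it, and
re-enters.  Hence no inclusion "skip family ⊆ annular family" can give `Skip ≤ annMass`; the correct
relation is the first-entry factorisation of `…SkipFirstEntry` (bridge part + bridge × returning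
record-ending descent).  Elementary (explicit walk, integer arithmetic). [folklore]
-/

noncomputable section

namespace Summit.CriticalPhenomena.SAWScalingLimit.Theorems.AnnularMassDecay.Radial

open scoped BigOperators Classical
open Literature.Probability.LatticeModels Literature.Probability.RandomPlanarGeometry
open Summit.CriticalPhenomena.SAWScalingLimit.Theorems.AnnularMassDecay.Negative (ax dist_ax_zero)

/-! ### Radii of lattice points about the origin, as integers -/

/-- `|v| = √(v₀² + v₁²)` for a lattice point `v` (centre `0`). [folklore] -/
theorem rr_st_dist_zero (v : Site 2) :
    dist (Site.toComplex v) 0 = Real.sqrt (((v 0 ^ 2 + v 1 ^ 2 : ℤ)) : ℝ) := by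
  rw [dist_zero_right, Complex.norm_def, Complex.normSq_apply, Site.toComplex_re, Site.toComplex_im]
  congr 1
  push_cast
  ring

/-- Comparison of radii is comparison of integer squared norms. [folklore] -/
theorem rr_st_dist_lt_dist (v w : Site 2) :
    dist (Site.toComplex v) 0 < dist (Site.toComplex w) 0 ↔ v 0 ^ 2 + v 1 ^ 2 < w 0 ^ 2 + w 1 ^ 2 := by
  rw [rr_st_dist_zero, rr_st_dist_zero, Real.sqrt_lt_sqrt_iff (by positivity), Int.cast_lt]

/-- `|v| ≤ 1 ↔ v₀² + v₁² ≤ 1`. [folklore] -/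
theorem rr_st_dist_le_one (v : Site 2) : dist (Site.toComplex v) 0 ≤ 1 ↔ v 0 ^ 2 + v 1 ^ 2 ≤ 1 := by
  rw [rr_st_dist_zero, Real.sqrt_le_left zero_le_one, one_pow, ← Int.cast_one (R := ℝ), Int.cast_le]

/-- `|v| ≤ 2 ↔ v₀² + v₁² ≤ 4`. [folklore] -/
theorem rr_st_dist_le_two (v : Site 2) : dist (Site.toComplex v) 0 ≤ 2 ↔ v 0 ^ 2 + v 1 ^ 2 ≤ 4 := by
  rw [rr_st_dist_zero, Real.sqrt_le_left zero_le_two, show (2 : ℝ) ^ 2 = ((4 : ℤ) : ℝ) by norm_num,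
    Int.cast_le]

/-- `2 < |v| ↔ 4 < v₀² + v₁²`. [folklore] -/
theorem rr_st_two_lt_dist (v : Site 2) : 2 < dist (Site.toComplex v) 0 ↔ 4 < v 0 ^ 2 + v 1 ^ 2 := by
  rw [rr_st_dist_zero, Real.lt_sqrt zero_le_two, show (2 : ℝ) ^ 2 = ((4 : ℤ) : ℝ) by norm_num,
    Int.cast_lt]

/-! ### The example -/

/-- **A re-entrant skipping member** (registered helper `rr_st_reentrant_example` for
`stub_skipTail`).  With `z = 0`, `u = (4,0)`, `A = B = 2`, `n = 8`, the walk
`(4,0)→(3,0)→(2,0)→(1,0)→(1,1)→(1,2)→(0,2)→(0,1)→(0,0)` (shifted to start at `0`, frozen after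
time `8`) is a self-avoiding walk satisfying the skip clauses of S3 verbatim, yet for NO inner radius
`s' ≥ 1` and no outer radius `R` is it an annular bridge of the crux's family (`annMass 0 s' R u N`):
its interior vertex at time `3` has radius `1 ≤ s'`.  So the skip family is not contained in any
first-entry family the crux controls. [folklore] -/
theorem rr_st_reentrant_example :
    ∃ (z : ℂ) (u : Site 2) (A B : ℝ) (n : ℕ) (ω : ℕ → Site 2),
      1 < A ∧ 1 ≤ B ∧ A * B ≤ dist (Site.toComplex u) z ∧ ω ∈ SAW.Zd.saws 2 n ∧
      (dist (Site.toComplex (u + ω n)) z ≤ dist (Site.toComplex u) z / (A * B) ∧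
        0 < n ∧
        (∀ i, 0 < i → i ≤ n → dist (Site.toComplex (u + ω i)) z < dist (Site.toComplex u) z) ∧
        (∀ i, i < n → dist (Site.toComplex (u + ω n)) z < dist (Site.toComplex (u + ω i)) z) ∧
        dist (Site.toComplex (u + ω n)) z ≤ dist (Site.toComplex u) z / A ∧
        (∀ t, 0 < t → t < n →
          (∀ i, i < t → dist (Site.toComplex (u + ω t)) z < dist (Site.toComplex (u + ω i)) z) →
          (∀ j, t < j → j ≤ n → dist (Site.toComplex (u + ω j)) z < dist (Site.toComplex (u + ω t)) z) →
          dist (Site.toComplex u) z / A < dist (Site.toComplex (u + ω t)) z)) ∧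
      ∀ (s' R : ℝ), 1 ≤ s' →
        ¬ ((∀ i, 0 < i → i < n → s' < dist (Site.toComplex (u + ω i)) z ∧
              dist (Site.toComplex (u + ω i)) z < R) ∧
            dist (Site.toComplex (u + ω n)) z ≤ s') := by
  refine ⟨0, ax 4, 2, 2, 8,
    fun i => if i ≤ 3 then ![-(i : ℤ), 0] else if i ≤ 5 then ![-3, (i : ℤ) - 3]
      else if i = 6 then ![-4, 2] else if i = 7 then ![-4, 1] else ![-4, 0],
    by norm_num, by norm_num, ?_, ?_, ⟨?_, by norm_num, ?_, ?_, ?_, ?_⟩, ?_⟩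
  · -- `A * B ≤ |u|`
    rw [dist_ax_zero]; norm_num
  · -- a self-avoiding walk of length 8 from `0`
    rw [SAW.Zd.mem_saws]
    refine ⟨?_, ?_, ?_, ?_⟩
    · funext j; fin_cases j <;> decide
    · intro i hi
      have h3 : ¬ i ≤ 3 := by omega
      have h5 : ¬ i ≤ 5 := by omega
      have h6 : i ≠ 6 := by omega
      have h7 : i ≠ 7 := by omega
      simp [h3, h5, h6, h7]
    · intro i hi
      interval_cases i <;> rw [zdGraph_adj_iff]
      · exact ⟨0, Or.inr (by funext j; fin_cases j <;> simp)⟩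
      · exact ⟨0, Or.inr (by funext j; fin_cases j <;> simp)⟩
      · exact ⟨0, Or.inr (by funext j; fin_cases j <;> simp)⟩
      · exact ⟨1, Or.inl (by funext j; fin_cases j <;> simp)⟩
      · exact ⟨1, Or.inl (by funext j; fin_cases j <;> simp)⟩
      · exact ⟨0, Or.inr (by funext j; fin_cases j <;> simp)⟩
      · exact ⟨1, Or.inr (by funext j; fin_cases j <;> simp)⟩
      · exact ⟨1, Or.inr (by funext j; fin_cases j <;> simp)⟩
    · intro i hi j hj h
      simp only [Set.mem_setOf_eq] at hi hj
      have key : ∀ i ≤ 8, ∀ j ≤ 8,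
          (fun i : ℕ => if i ≤ 3 then ![-(i : ℤ), 0] else if i ≤ 5 then ![-3, (i : ℤ) - 3]
            else if i = 6 then ![-4, 2] else if i = 7 then ![-4, 1] else (![-4, 0] : Site 2)) i 0 =
          (fun i : ℕ => if i ≤ 3 then ![-(i : ℤ), 0] else if i ≤ 5 then ![-3, (i : ℤ) - 3]
            else if i = 6 then ![-4, 2] else if i = 7 then ![-4, 1] else (![-4, 0] : Site 2)) j 0 →
          (fun i : ℕ => if i ≤ 3 then ![-(i : ℤ), 0] else if i ≤ 5 then ![-3, (i : ℤ) - 3]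
            else if i = 6 then ![-4, 2] else if i = 7 then ![-4, 1] else (![-4, 0] : Site 2)) i 1 =
          (fun i : ℕ => if i ≤ 3 then ![-(i : ℤ), 0] else if i ≤ 5 then ![-3, (i : ℤ) - 3]
            else if i = 6 then ![-4, 2] else if i = 7 then ![-4, 1] else (![-4, 0] : Site 2)) j 1 →
          i = j := by
        decide
      exact key i hi j hj (congrFun h 0) (congrFun h 1)
  · -- end radius `0 ≤ |u| / (A B) = 1`
    rw [dist_ax_zero, show |((4 : ℤ) : ℝ)| / (2 * 2) = 1 by norm_num, rr_st_dist_le_one]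
    decide
  · -- confined to the open disc of radius `|u| = 4`
    intro i hi0 hi8
    rw [rr_st_dist_lt_dist]
    interval_cases i <;> decide
  · -- the end is a strict radial record
    intro i hi
    rw [rr_st_dist_lt_dist]
    interval_cases i <;> decide
  · -- end radius `≤ |u| / A = 2`
    rw [dist_ax_zero, show |((4 : ℤ) : ℝ)| / 2 = 2 by norm_num, rr_st_dist_le_two]
    decide
  · -- no renewal of radius `≤ 2` before the end
    intro t ht0 ht8 hR hF
    rw [dist_ax_zero, show |((4 : ℤ) : ℝ)| / 2 = 2 by norm_num, rr_st_two_lt_dist]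
    interval_cases t
    · decide
    · exact absurd ((rr_st_dist_lt_dist _ _).1 (hF 5 (by norm_num) (by norm_num))) (by decide)
    · exact absurd ((rr_st_dist_lt_dist _ _).1 (hF 5 (by norm_num) (by norm_num))) (by decide)
    · exact absurd ((rr_st_dist_lt_dist _ _).1 (hR 3 (by norm_num))) (by decide)
    · exact absurd ((rr_st_dist_lt_dist _ _).1 (hR 3 (by norm_num))) (by decide)
    · exact absurd ((rr_st_dist_lt_dist _ _).1 (hR 3 (by norm_num))) (by decide)
    · exact absurd ((rr_st_dist_lt_dist _ _).1 (hR 3 (by norm_num))) (by decide)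
  · -- not an annular bridge for any inner radius `s' ≥ 1`: time `3` has radius `1`
    rintro s' R hs' ⟨hint, -⟩
    have h3 := (hint 3 (by norm_num) (by norm_num)).1
    have h1 : dist (Site.toComplex (ax 4 +
        (fun i : ℕ => if i ≤ 3 then ![-(i : ℤ), 0] else if i ≤ 5 then ![-3, (i : ℤ) - 3]
          else if i = 6 then ![-4, 2] else if i = 7 then ![-4, 1] else (![-4, 0] : Site 2)) 3)) 0 ≤ 1 := by
      rw [rr_st_dist_le_one]; decide
    linarith

end Summit.CriticalPhenomena.SAWScalingLimit.Theorems.AnnularMassDecay.Radial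

end
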